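import Literature.Geometry.Lorentzian.KerrSchild
import HarnessLib

/-!
# `KerrShieldedDataExist` — negative lemma: no junction window without sub-extremality

Support lemma for crux `stmt-FinalStateConjecture-10055`
(`Summit.FinalStateConjecture.FinalStateConjecture.Theses.SwallowTheDatum.KerrShieldedDataExist`): the
typed junction window `Kerr.rMinus M a < r₁ < Kerr.rPlus M a` is EMPTY unless `|a| < M` (for `M ≤ |a|`
the square root `√(M² − a²)` is the junk value `0` or vanishes). Consequences: the conjunct `|a| < M` of
the crux is redundant given the window and `0 ≤ M`, and the natural strengthening of the crux to
extremal / super-extremal shields is false for this trivial reason (refuted strengthening, recorded by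
the standing disprover; see `Cruxes/KerrShieldedDataExist/Disproof.lean` §2, §7).
-/

namespace Summit.FinalStateConjecture.FinalStateConjecture.Theorems.KerrShieldedDataExist.Negative

open Literature.Geometry.Lorentzian

/-- A nonempty junction window `r₋ < r₁ < r₊` with `0 ≤ M` forces `|a| < M`. [folklore] -/
theorem abs_lt_of_window {M a r₁ : ℝ} (hM : 0 ≤ M) (h₁ : Kerr.rMinus M a < r₁)
    (h₂ : r₁ < Kerr.rPlus M a) : |a| < M := by
  have hlt : Kerr.rMinus M a < Kerr.rPlus M a := h₁.trans h₂
  unfold Kerr.rMinus Kerr.rPlus at hlt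
  have hs : 0 < Real.sqrt (M ^ 2 - a ^ 2) := by linarith
  have hpos : 0 < M ^ 2 - a ^ 2 := Real.sqrt_pos.1 hs
  exact abs_lt_of_sq_lt_sq (by linarith) hM

/-- **No junction window for extremal or super-extremal parameters**: if `0 ≤ M ≤ |a|` then
`¬ (Kerr.rMinus M a < r₁ ∧ r₁ < Kerr.rPlus M a)` for every `r₁`. [folklore] -/
theorem no_window_of_not_subextremal {M a : ℝ} (hM : 0 ≤ M) (ha : M ≤ |a|) (r₁ : ℝ) :
    ¬ (Kerr.rMinus M a < r₁ ∧ r₁ < Kerr.rPlus M a) := fun h =>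
  absurd (abs_lt_of_window hM h.1 h.2) (not_lt.2 ha)

end Summit.FinalStateConjecture.FinalStateConjecture.Theorems.KerrShieldedDataExist.Negative
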